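import Summits.AtomisticToContinuum.BoseEinsteinCondensation.Theses.BECInsertionCorrector
import Summits.AtomisticToContinuum.BoseEinsteinCondensation.Theorems.CorrectorClosure.Negative.InsertionResidueUniformWindowFalse
import HarnessLib

/-!
# Route `BECInsertionCorrector`, support item `ResidueCondenses` (stmt-AtomisticToContinuum-12059)

**An insertion residue bounded below forces torus BEC of near-minimisers.** Let `Θ` be a
normalised periodic `N`-body trial state and `Ψ` a periodic `(N+1)`-body trial state on the torus
of side `L > 0`. The zero-momentum insertion overlap
`L⁻³ |∫_(cell^N) conj Θ(X) ∫_cell Ψ(x, X) dx dX|² = |⟨φ₀ ⊗ Θ, Ψ⟩|²` (`φ₀ = L^{-3/2}` the constant mode)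
is, by Cauchy–Schwarz in `X` against the normalised `Θ`, at most the tagged zero-mode occupation
`⟨Ψ, P_{Ω,0} Ψ⟩ = L⁻³ ∫_(cell^N) |∫_cell Ψ(x, X) dx|² dX`, and `(N+1)` times the latter is
`⟨Ψ, n₀ Ψ⟩ = condensateOccupation (N+1) L Ψ`; both steps are the landed lemma
`CorrectorClosure.Negative.succ_mul_overlap_sq_le_condensateOccupation`
(`(N+1) L⁻³ |overlap|² ≤ ⟨Ψ, n₀ Ψ⟩`). Hence `InsertionResidue` (overlap `≥ c` for every
`δ`-near-minimiser `Ψ` of the periodic `(N+1)`-body problem and some normalised `Θ`) gives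
`condensateOccupation (N+1) L Ψ ≥ c (N+1)` for the same `Ψ` and the same window `δ`, i.e. the
`PeriodicBEC` signature at particle number `N + 1` (boxes agree: `sideLength ρ (N+1)` on both
sides); the `∀ᶠ N` shift `N ↦ N + 1` is bookkeeping (`Filter.eventually_atTop`).

* `ofReal_mul_natCast_succ` — `ofReal (c (N+1)) = (N+1) · ofReal c`;
* `ResidueCondenses_proof` — the route decl, closing item stmt-AtomisticToContinuum-12059.

References: [PenroseOnsager1956] (criterion), [LSSY2005, §1.2 (1.17)–(1.18)] (occupation),
[Fournais2020, (1.3)–(1.4)] (`P_{Ω,j}`, `n₀`). The argument is folklore.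
-/

noncomputable section

open MeasureTheory Filter
open scoped ENNReal NNReal ComplexConjugate

namespace Summit.AtomisticToContinuum.BoseEinsteinCondensation.Theorems

open Literature.MathematicalPhysics.QuantumManyBody.BoseGas
open Summit.AtomisticToContinuum.BoseEinsteinCondensation.Theorems.CorrectorClosure.Negative

/-- `ofReal (c (N+1)) = (N+1) · ofReal c` in `ℝ≥0∞` for `c ≥ 0`. [folklore] -/
theorem ofReal_mul_natCast_succ {c : ℝ} (hc : 0 ≤ c) (N : ℕ) :
    ENNReal.ofReal (c * ((N + 1 : ℕ) : ℝ)) = (N + 1 : ℝ≥0∞) * ENNReal.ofReal c := by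
  rw [ENNReal.ofReal_mul hc, ENNReal.ofReal_natCast, mul_comm]
  push_cast
  rfl

/-- **Item stmt-AtomisticToContinuum-12059** (`ResidueCondenses` of route `BECInsertionCorrector`):
a uniformly positive zero-momentum insertion residue between some normalised `N`-body state `Θ` and
every `δ`-near-minimiser `Ψ` of the periodic `(N+1)`-body energy on the torus of side
`((N+1)/ρ)^{1/3}` gives torus BEC of those near-minimisers, `⟨Ψ, n₀ Ψ⟩ ≥ c (N+1)`, eventually in `N`
(the `PeriodicBEC` signature, read at particle number `N + 1`). [folklore] -/
theorem ResidueCondenses_proof :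
    Summit.AtomisticToContinuum.BoseEinsteinCondensation.Theses.BECInsertionCorrector.ResidueCondenses := by
  unfold Summit.AtomisticToContinuum.BoseEinsteinCondensation.Theses.BECInsertionCorrector.ResidueCondenses
    Summit.AtomisticToContinuum.BoseEinsteinCondensation.Theses.BECInsertionCorrector.InsertionResidue
  intro hIR v hv
  obtain ⟨ρ₀, hρ₀, hρ⟩ := hIR v hv
  refine ⟨ρ₀, hρ₀, fun ρ hρpos hρlt => ?_⟩
  obtain ⟨c, hc, hN⟩ := hρ ρ hρpos hρlt
  refine ⟨c, hc, ?_⟩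
  rw [Filter.eventually_atTop] at hN ⊢
  obtain ⟨N₀, hN₀⟩ := hN
  refine ⟨N₀ + 1, fun M hM => ?_⟩
  -- read the goal at particle number `M = N + 1`
  obtain ⟨N, rfl⟩ : ∃ N, M = N + 1 := ⟨M - 1, by omega⟩
  obtain ⟨δ, hδ, Θ, _hΘ, hΨ⟩ := hN₀ N (by omega)
  refine ⟨δ, hδ, fun Ψ hΨE => ?_⟩
  have hL : 0 < sideLength ρ (N + 1) := sideLength_succ_pos hρpos N
  calc ENNReal.ofReal (c * ((N + 1 : ℕ) : ℝ))
      = (N + 1 : ℝ≥0∞) * ENNReal.ofReal c := ofReal_mul_natCast_succ hc.le N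
    _ ≤ (N + 1 : ℝ≥0∞) * (ENNReal.ofReal ((sideLength ρ (N + 1) ^ 3)⁻¹) *
          (‖∫ X in cellN N (sideLength ρ (N + 1)), conj (Θ.ψ X) *
              ∫ x in cell (sideLength ρ (N + 1)), Ψ.ψ (Matrix.vecCons x X)‖₊ : ℝ≥0∞) ^ 2) := by
        gcongr
        exact hΨ Ψ hΨE
    _ ≤ condensateOccupation (N + 1) (sideLength ρ (N + 1)) Ψ.ψ :=
        succ_mul_overlap_sq_le_condensateOccupation hL Θ Ψ

end Summit.AtomisticToContinuum.BoseEinsteinCondensation.Theorems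

end
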